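import Literature.Topology.FourManifolds.FlowerSectorRetraction
import Literature.Topology.FourManifolds.FlowerTipGeometry
import Literature.AlgebraicTopology.Homotopy.SquareCrossRetract
import Literature.AlgebraicTopology.Homotopy.StrongDeformationRetractTransport
import Literature.AlgebraicTopology.Homotopy.StrongDeformationRetractUnion
import Literature.AlgebraicTopology.FundamentalGroup.RetractionInclusionFormula
import Literature.AlgebraicTopology.FundamentalGroup.BallWithArcsBasis
import Literature.Topology.FourManifolds.GroupTrisections
import HarnessLib

/-!
# A sector of the flower surface: the ball with two arcs and the free basis at the lens tip

Topic `Literature/Topology/FourManifolds`; sequel of `FlowerSectorRetraction.lean` and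
`FlowerTipGeometry.lean` for the fact seat `provefact-Literature.Topology.FourManifolds.exists-cbed50d78a`
(named fact (g′) `Literature.Topology.FourManifolds.exists_marking_centralSurface_of_gkTrisection`:
the central surface of a `(g, k)`-trisection is marked by `S_g`).  The sector
`sectorZ g = Z ∩ π⁻¹(wedge)` of the model surface `Z = {q_g + z² = c_g}` strong deformation retracts
onto its reduced spine `spineZ'` (a figure eight: the lens circle `L` through `I = (ρ₁, 0, 0)` and
`P = (7^{1/20g}, 0, 0)`, and the circle `C₁` over the axis segment `[7^{1/20g}, ρ₃]` through `P`
and `Q = (ρ₃, 0, 0)`), `FlowerSectorRetraction.lean`.  Here: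

* §1–§2 `mem_spineZ'_iff`, `tipChart_mem_spineZ'_iff` — the tip chart (a closed square around
  `P` in `Z`, `FlowerTipGeometry.lean`) meets the reduced spine exactly in the cross `{x = 0} ∪ {y = 0}`;
* §3 `spineZ'_isStrongDeformationRetractOf_ballArcs`, `bijective_inclHom_ballArcs_sectorZ` — the
  "ball with arcs" `spineZ' ∪ tipPatch` strong deformation retracts onto `spineZ'`
  (`SquareCross.isStrongDeformationRetractOf_cross_closedBall` transported by the tip chart and
  glued by `IsStrongDeformationRetractOf.union_of_inter_subset`), so on `π₁` its inclusion in the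
  sector is an isomorphism (two-out-of-three);
* §4 `arcC`, `arcL` — the two arcs of the reduced spine outside the tip patch (the `C₁`-arc through
  `Q` and the lens arc through `I`) as injective continuous maps of `[-1, 1]`, disjoint, meeting the
  tip patch exactly in their end points; `ballArcs'_eq : range tipChart ∪ ⋃ range arcs = spineZ' ∪ tipPatch`;
* §5 `exists_mulEquiv_sectorZ_apply` — **the free basis of `π₁(sector, P)`**: an isomorphism
  `F⟨a, b⟩ ≅ π₁(sectorZ g, P)` sending `a`, `b` to the classes of the arc loops `arcLoop` (approach
  path inside the tip patch, the arc traversed from its right end point to its left one, approach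
  path back), by `BallWithArcsBasis.exists_mulEquiv_apply_of_eq_arcLoop` (Hatcher, Example 1.22).

Everything is proved; no named facts.

## References

* A. Hatcher, *Algebraic Topology*, CUP (2002), Example 1.22 (p. 43), Prop. 1.17, §1.2 p. 51.
  [HatcherAT2002]
* D. Gay, R. Kirby, *Trisecting 4-manifolds*, Geom. Topol. 20 (2016), Def. 1, Remark 2. [GayKirby2016]
-/

open scoped Manifold ContDiff Topology InnerProductSpace Real unitInterval
open Set Function Filter Metric Module Complex

noncomputable section

namespace Literature.Topology.FourManifolds

/-- Local notation: `𝔼 n` is the model Euclidean space `EuclideanSpace ℝ (Fin n)`. -/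
local notation "𝔼 " n:arg => EuclideanSpace ℝ (Fin n)

open PlanarThickening PlanarDouble Literature.AlgebraicTopology.Homotopy
  Literature.AlgebraicTopology.FundamentalGroup

namespace FlowerModel

variable {g : ℕ}

/-! ### §1 Points of the reduced spine -/

/-- Membership in the flower surface is the level-set condition. [folklore] -/
theorem mem_flowerSurface_iff {p : 𝔼 3} : p ∈ flowerSurface g ↔ thicken (flower g) p = level g := Iff.rfl

/-- **Points of the reduced spine**: `π p = pol r (±θ_lo r)` with `ρ₁ ≤ r ≤ ρ₃`. [folklore] -/
theorem mem_spineZ'_iff (hg : 2 ≤ g) {p : 𝔼 3} :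
    p ∈ spineZ' g hg ↔ thicken (flower g) p = level g ∧
      ∃ r ∈ Icc (rho1 hg) (rho3 hg), proj p = pol r (thlo g r) ∨ proj p = pol r (-thlo g r) := by
  constructor
  · rintro ⟨hp, h3⟩
    have h3' : ‖proj p‖ ≤ rho3 hg := h3
    obtain ⟨⟨h1, -⟩, h⟩ := proj_eq_of_mem_spineZ hg hp
    refine ⟨hp.1, ‖proj p‖, ⟨h1, h3'⟩, ?_⟩
    rcases h with ⟨-, h⟩ | ⟨-, h⟩
    · exact Or.inl h
    · exact Or.inr h
  · rintro ⟨hq, r, ⟨hr1, hr3⟩, h⟩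
    have hr0 : 0 ≤ r := le_trans (rho1_pos hg).le hr1
    have hr4 : r ≤ rho4 hg := le_trans hr3 (rho3_lt_rho4 hg).le
    have hnorm : ‖proj p‖ = r := by
      rcases h with h | h <;> rw [h, norm_pol, abs_of_nonneg hr0]
    refine ⟨⟨hq, ?_⟩, by show ‖proj p‖ ≤ rho3 hg; rw [hnorm]; exact hr3⟩
    show proj p ∈ spineFloor g hg
    rcases h with h | h
    · exact Or.inl ⟨r, ⟨hr1, hr4⟩, h.symm⟩
    · exact Or.inr ⟨pol r (thlo g r), ⟨r, ⟨hr1, hr4⟩, rfl⟩, by rw [refl_pol, h]⟩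

/-- The reduced spine is closed. [folklore] -/
theorem isClosed_spineZ' (hg : 2 ≤ g) : IsClosed (spineZ' g hg) :=
  (isClosed_spineZ hg).inter (isClosed_le (continuous_norm.comp proj.continuous) continuous_const)

/-- The reduced spine lies in the sector. [folklore] -/
theorem spineZ'_subset_sectorZ (hg : 2 ≤ g) : spineZ' g hg ⊆ sectorZ g := fun _ hp =>
  ⟨hp.1.1, floorSetW_subset_wedge hg (spineFloor_subset hg hp.1.2)⟩

/-- **The lens tip `P` lies on the reduced spine.** [folklore] -/
theorem ptP_mem_spineZ' (hg : 2 ≤ g) : ptP g ∈ spineZ' g hg := by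
  have hg1 : 1 ≤ g := by omega
  refine (mem_spineZ'_iff hg).2 ⟨thicken_ptP g, rt g 7, ⟨(rho1_lt_rt_seven hg).le, (rt_seven_lt_rho3 hg).le⟩,
    Or.inl ?_⟩
  rw [ptP, proj_lift, thlo_eq_zero_of_mem hg le_rfl (rt_seven_lt_rho3 hg).le, pol_zero_right]

/-! ### §2 The tip patch meets the reduced spine in the cross -/

/-- `20^{1/20g} < ρ₃`. [folklore] -/
theorem rt_twenty_lt_rho3 (hg : 2 ≤ g) : rt g 20 < rho3 hg :=
  lt_trans (rt_twenty_lt_rb hg) (rho3_mem hg).1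

/-- The angle of a lens floor point is its floor angle. [folklore] -/
theorem arg_pol_thlo (hg : 2 ≤ g) {r : ℝ} (hr : 0 < r) : Complex.arg (toC (pol r (thlo g r))) = thlo g r :=
  arg_toC_pol hr (mem_Ioc_of_mem (by omega) (thlo_nonneg _) (thlo_le (by omega) r))

/-- The angle of a reflected lens floor point. [folklore] -/
theorem arg_pol_neg_thlo (hg : 2 ≤ g) {r : ℝ} (hr : 0 < r) :
    Complex.arg (toC (pol r (-thlo g r))) = -thlo g r := by
  have h1 := thlo_nonneg (g := g) r
  have h2 := thlo_le (g := g) (by omega) r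
  have hg' : (2 : ℝ) ≤ g := by exact_mod_cast hg
  have h3 : π / g ≤ π / 2 := div_le_div_of_nonneg_left Real.pi_pos.le two_pos hg'
  exact arg_toC_pol hr ⟨by linarith [Real.pi_pos], by linarith [Real.pi_pos]⟩

/-- **The tip chart meets the reduced spine exactly in the cross `{x = 0} ∪ {y = 0}`.** [folklore] -/
theorem tipChart_mem_spineZ'_iff (hg : 2 ≤ g) (z : closedBall (0 : ℝ × ℝ) 1) :
    tipChart hg z ∈ spineZ' g hg ↔ z.1.1 = 0 ∨ z.1.2 = 0 := by
  have hg1 : 1 ≤ g := by omega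
  obtain ⟨hx, hy⟩ := abs_le_one_of_mem_closedBall z.2
  have hspec := tipR_spec hg z
  have hR0 : 0 < tipR hg z := tipR_pos hg z
  have hR4 : (tipR hg z) ≤ rho4 hg := le_trans hspec.1.2 (le_of_lt (lt_trans (rt_twenty_lt_rho3 hg) (rho3_lt_rho4 hg)))
  have hproj := proj_tipChart hg z
  have htwo := tipChart_apply_two hg z
  have hθ := abs_θ₀_mul_le hg hx
  constructor
  · intro hmem
    obtain ⟨-, r, ⟨hr1, hr3⟩, h⟩ := (mem_spineZ'_iff hg).1 hmem
    rw [hproj] at h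
    have hr0 : 0 < r := lt_of_lt_of_le (rho1_pos hg) hr1
    -- radii agree
    have hRr : (tipR hg z) = r := by
      rcases h with h' | h'
      · have := congrArg (fun u : 𝔼 2 => ‖u‖) h'
        simpa [norm_pol, abs_of_pos hR0, abs_of_pos hr0] using this
      · have := congrArg (fun u : 𝔼 2 => ‖u‖) h'
        simpa [norm_pol, abs_of_pos hR0, abs_of_pos hr0] using this
    subst hRr
    -- angles agree
    have hang : θ₀ hg * z.1.1 = thlo g (tipR hg z) ∨ θ₀ hg * z.1.1 = -thlo g (tipR hg z) := by
      rcases h with h | h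
      · left
        have := congrArg (fun u : 𝔼 2 => Complex.arg (toC u)) h
        rwa [arg_toC_pol hR0 (θ₀_mul_mem_Ioc hg hx), arg_pol_thlo hg hR0] at this
      · right
        have := congrArg (fun u : 𝔼 2 => Complex.arg (toC u)) h
        rwa [arg_toC_pol hR0 (θ₀_mul_mem_Ioc hg hx), arg_pol_neg_thlo hg hR0] at this
    rcases le_or_gt (rt g 7) (tipR hg z) with h7 | h7
    · -- on `m`: the floor angle vanishes, so `x = 0`
      left
      have h0 : thlo g (tipR hg z) = 0 := thlo_eq_zero_of_mem hg h7 hr3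
      rw [h0, neg_zero, or_self] at hang
      exact (mul_eq_zero.1 hang).resolve_left (θ₀_pos hg).ne'
    · -- in the lens range: the floor point is a seam point, so the height `t₀ y` vanishes
      right
      have hseam : flower g (pol (tipR hg z) (thlo g (tipR hg z))) = level g :=
        (flower_pol_thlo_eq_level_iff hg hR0 hR4).2 ((level_le_prof_iff hg hR0.le).2 (Or.inl ⟨hr1, h7.le⟩))
      have hq : flower g (pol (tipR hg z) (θ₀ hg * z.1.1)) = level g := by
        rcases hang with ha | ha
        · rw [ha]; exact hseam
        · rw [ha, flower_pol_neg]; exact hseam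
      have := hspec.2
      rw [hq] at this
      have ht : (t₀ g * z.1.2) ^ 2 = 0 := by linarith
      exact (mul_eq_zero.1 (pow_eq_zero_iff two_ne_zero |>.1 ht)).resolve_left (t₀_pos hg).ne'
  · intro hz
    refine (mem_spineZ'_iff hg).2 ⟨thicken_tipChart hg z, (tipR hg z), ?_⟩
    rcases hz with hz | hz
    · -- `x = 0`: the point lies over the axis beyond the lens tip
      have hq : prof g (tipR hg z) ≤ level g := by
        have := hspec.2
        rw [hz, mul_zero, pol_zero_right, flower_ax'] at this
        nlinarith [sq_nonneg (t₀ g * z.1.2)]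
      rcases (prof_le_level_iff hg hR0.le).1 hq with h | h
      · exact absurd (lt_of_lt_of_le (rho1_lt_rstar hg) hspec.1.1) (not_lt.2 h)
      · refine ⟨⟨le_trans (rho1_lt_rt_seven hg).le h.1, h.2⟩, Or.inl ?_⟩
        rw [hproj, hz, mul_zero, thlo_eq_zero_of_mem hg h.1 h.2]
    · -- `y = 0`: a seam point, hence on the lens curve
      have hq : flower g (pol (tipR hg z) (θ₀ hg * z.1.1)) = level g := by
        have := hspec.2; rw [hz, mul_zero] at this; simpa using this
      have hθabs := abs_le.1 hθ
      have hθpi : θ₀ hg ≤ π / g := θ₀_le_pi_div hg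
      rcases le_or_gt 0 (θ₀ hg * z.1.1) with hs | hs
      · obtain ⟨hlev, hang⟩ := (flower_pol_eq_level_iff hg hR0 hR4 hs (by linarith)).1 hq
        refine ⟨?_, Or.inl (by rw [hproj, hang])⟩
        rcases (level_le_prof_iff hg hR0.le).1 hlev with h | h
        · exact ⟨h.1, le_trans h.2 (rt_seven_lt_rho3 hg).le⟩
        · exact absurd (lt_of_le_of_lt hspec.1.2 (rt_twenty_lt_rho3 hg)) (not_lt.2 h)
      · have hq' : flower g (pol (tipR hg z) (-(θ₀ hg * z.1.1))) = level g := by rw [flower_pol_neg]; exact hq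
        obtain ⟨hlev, hang⟩ := (flower_pol_eq_level_iff hg hR0 hR4 (by linarith) (by linarith)).1 hq'
        refine ⟨?_, Or.inr (by rw [hproj, ← neg_neg (θ₀ hg * z.1.1), hang])⟩
        rcases (level_le_prof_iff hg hR0.le).1 hlev with h | h
        · exact ⟨h.1, le_trans h.2 (rt_seven_lt_rho3 hg).le⟩
        · exact absurd (lt_of_le_of_lt hspec.1.2 (rt_twenty_lt_rho3 hg)) (not_lt.2 h)

/-- **The tip patch meets the reduced spine in the image of the cross.** [folklore] -/
theorem tipPatch_inter_spineZ' (hg : 2 ≤ g) :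
    tipPatch g hg ∩ spineZ' g hg = tipChart hg '' (Subtype.val ⁻¹' SquareCross.cross) := by
  ext p
  constructor
  · rintro ⟨hp, hs⟩
    rw [← range_tipChart hg] at hp
    obtain ⟨z, rfl⟩ := hp
    exact ⟨z, (tipChart_mem_spineZ'_iff hg z).1 hs, rfl⟩
  · rintro ⟨z, hz, rfl⟩
    exact ⟨by rw [← range_tipChart hg]; exact mem_range_self z, (tipChart_mem_spineZ'_iff hg z).2 hz⟩

/-! ### §3 The tip patch glued to the reduced spine deformation retracts onto the reduced spine -/

/-- The tip chart is a closed embedding of the square. [folklore] -/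
theorem isClosedEmbedding_tipChart (hg : 2 ≤ g) : Topology.IsClosedEmbedding (tipChart hg) := by
  haveI : CompactSpace (closedBall (0 : ℝ × ℝ) 1) := isCompact_iff_compactSpace.1 (isCompact_closedBall 0 1)
  exact (tipChart hg).continuous.isClosedEmbedding (injective_tipChart hg)

/-- **The tip patch strong deformation retracts onto its trace on the reduced spine** (the image
of the cross under the tip chart). [folklore] -/
theorem isStrongDeformationRetractOf_tipPatch (hg : 2 ≤ g) :
    IsStrongDeformationRetractOf (tipPatch g hg ∩ spineZ' g hg) (tipPatch g hg) := by
  -- in the square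
  have h0 := SquareCross.isStrongDeformationRetractOf_cross_closedBall (1 : ℝ)
  have h1 := h0.preimage_val (W := closedBall (0 : ℝ × ℝ) 1) le_rfl
  have h2 := h1.image_of_isEmbedding (isClosedEmbedding_tipChart hg).isEmbedding
  have e1 : tipChart hg '' (Subtype.val ⁻¹' closedBall (0 : ℝ × ℝ) 1) = tipPatch g hg := by
    rw [← range_tipChart hg, ← image_univ]
    congr 1
    exact eq_univ_of_forall fun z => z.2
  have e2 : tipChart hg '' (Subtype.val ⁻¹' (SquareCross.cross ∩ closedBall (0 : ℝ × ℝ) 1)) =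
      tipPatch g hg ∩ spineZ' g hg := by
    rw [tipPatch_inter_spineZ' hg]
    congr 1
    ext z
    exact ⟨fun h => h.1, fun h => ⟨h, z.2⟩⟩
  rwa [e1, e2] at h2

variable (g) in
/-- **The ball with two arcs**: the tip patch together with the reduced spine. [folklore] -/
def ballArcs (hg : 2 ≤ g) : Set (𝔼 3) := spineZ' g hg ∪ tipPatch g hg

/-- **The ball with arcs strong deformation retracts onto the reduced spine.** [folklore] -/
theorem spineZ'_isStrongDeformationRetractOf_ballArcs (hg : 2 ≤ g) :
    IsStrongDeformationRetractOf (spineZ' g hg) (ballArcs g hg) := by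
  refine IsStrongDeformationRetractOf.union_of_inter_subset (isStrongDeformationRetractOf_tipPatch hg)
    (fun p hp => ⟨hp.2, hp.1⟩) (fun p hp => hp.1.2) ?_ ?_
  · intro p hp
    rw [(isClosed_spineZ' hg).closure_eq] at hp; exact hp.1
  · intro p hp
    rw [(isCompact_tipPatch hg).isClosed.closure_eq] at hp; exact hp.1

/-- The tip patch lies in the sector. [folklore] -/
theorem tipPatch_subset_sectorZ (hg : 2 ≤ g) : tipPatch g hg ⊆ sectorZ g := by
  rintro p ⟨hq, -, hθ, -⟩
  refine ⟨hq, ?_, le_trans hθ (θ₀_le_pi_div hg)⟩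
  -- `q(π p) = c - p₂² ≤ c`
  have : flower g (proj p) + p 2 ^ 2 = level g := hq
  show flower g (proj p) ≤ level g
  nlinarith [sq_nonneg (p 2)]

/-- The ball with arcs lies in the sector. [folklore] -/
theorem ballArcs_subset_sectorZ (hg : 2 ≤ g) : ballArcs g hg ⊆ sectorZ g :=
  union_subset (spineZ'_subset_sectorZ hg) (tipPatch_subset_sectorZ hg)

/-- **On fundamental groups the inclusion of the ball with arcs into the sector is an isomorphism**
(both strong deformation retract onto the reduced spine). [folklore] -/
theorem bijective_inclHom_ballArcs_sectorZ (hg : 2 ≤ g) :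
    Bijective (VanKampen.inclHomOfSubset (ballArcs_subset_sectorZ hg) (ptP g)
      (Or.inl (ptP_mem_spineZ' hg) : ptP g ∈ ballArcs g hg) (ballArcs_subset_sectorZ hg (Or.inl (ptP_mem_spineZ' hg)))) :=
  VanKampen.bijective_inclHomOfSubset_of_bijective_of_bijective (subset_union_left : spineZ' g hg ⊆ ballArcs g hg)
    (ballArcs_subset_sectorZ hg) (ptP_mem_spineZ' hg)
    (VanKampen.bijective_inclHomOfSubset_of_isStrongDeformationRetractOf
      (spineZ'_isStrongDeformationRetractOf_ballArcs hg) subset_union_left (ptP_mem_spineZ' hg))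
    (VanKampen.bijective_inclHomOfSubset_of_isStrongDeformationRetractOf
      (spineZ'_isStrongDeformationRetractOf_sectorZ hg) (spineZ'_subset_sectorZ hg) (ptP_mem_spineZ' hg))


/-! ### §4 The two arcs of the reduced spine outside the tip patch -/

/-- The radius along the `C₁`-arc: `r₂` at `x = ±1`, `ρ₃` at `x = 0`. [folklore] -/
def radC (hg : 2 ≤ g) (x : ℝ) : ℝ := rtwo g + (1 - |x|) * (rho3 hg - rtwo g)

/-- The height along the `C₁`-arc. [folklore] -/
def htC (hg : 2 ≤ g) (x : ℝ) : ℝ := Real.sqrt (level g - prof g (radC hg x))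

/-- `r₂ < ρ₃`. [folklore] -/
theorem rtwo_lt_rho3 (hg : 2 ≤ g) : rtwo g < rho3 hg := lt_trans (rtwo_mem (by omega)).2 (rt_twenty_lt_rho3 hg)

/-- The `C₁`-radius lies in `[r₂, ρ₃]` for `|x| ≤ 1`. [folklore] -/
theorem radC_mem (hg : 2 ≤ g) {x : ℝ} (hx : |x| ≤ 1) : radC hg x ∈ Icc (rtwo g) (rho3 hg) := by
  have h := rtwo_lt_rho3 hg
  rw [radC]; constructor <;> nlinarith [abs_nonneg x]

/-- `f(radC x) ≤ c`. [folklore] -/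
theorem prof_radC_le (hg : 2 ≤ g) {x : ℝ} (hx : |x| ≤ 1) : prof g (radC hg x) ≤ level g := by
  have hm := radC_mem hg hx
  exact (prof_le_level_iff hg (le_trans (rt_pos (by norm_num) |>.le) (le_trans (rtwo_mem (by omega)).1.le hm.1))).2
    (Or.inr ⟨le_trans (rtwo_mem (by omega)).1.le hm.1, hm.2⟩)

/-- The `C₁`-radius is continuous. [folklore] -/
theorem continuous_radC (hg : 2 ≤ g) : Continuous (radC hg) := by unfold radC; fun_prop

/-- The `C₁`-height is continuous. [folklore] -/
theorem continuous_htC (hg : 2 ≤ g) : Continuous (htC hg) := by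
  unfold htC
  have := continuous_prof (g := g) (by omega)
  have := continuous_radC hg
  fun_prop

/-- At `x = 0` the `C₁`-radius is `ρ₃` and the height vanishes. [folklore] -/
theorem htC_zero (hg : 2 ≤ g) : htC hg 0 = 0 := by
  rw [htC, radC, abs_zero, sub_zero, one_mul, add_sub_cancel, prof_rho3 hg, sub_self, Real.sqrt_zero]

/-- **The `C₁`-arc** as a map on `ℝ`: upper sheet over the axis for `x ≤ 0`, lower sheet for
`x ≥ 0`, radius `radC x`. [folklore] -/
def arcCFun (hg : 2 ≤ g) (x : ℝ) : 𝔼 3 :=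
  if x ≤ 0 then lift (ax (radC hg x)) + htC hg x • ez else lift (ax (radC hg x)) + (-htC hg x) • ez

/-- The `C₁`-arc on `(-∞, 0]`. [folklore] -/
theorem arcCFun_of_le (hg : 2 ≤ g) {x : ℝ} (hx : x ≤ 0) : arcCFun hg x = lift (ax (radC hg x)) + htC hg x • ez := by
  rw [arcCFun, if_pos hx]

/-- The `C₁`-arc on `[0, ∞)`. [folklore] -/
theorem arcCFun_of_ge (hg : 2 ≤ g) {x : ℝ} (hx : 0 ≤ x) : arcCFun hg x = lift (ax (radC hg x)) + (-htC hg x) • ez := by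
  rcases hx.eq_or_lt with h | h
  · rw [← h, arcCFun, if_pos le_rfl, htC_zero hg, neg_zero]
  · rw [arcCFun, if_neg (not_le.2 h)]

/-- The `C₁`-arc is continuous. [folklore] -/
theorem continuous_arcCFun (hg : 2 ≤ g) : Continuous (arcCFun hg) := by
  have hax : Continuous fun x : ℝ => ax (radC hg x) := by
    unfold ax; exact toC.symm.continuous.comp (Complex.continuous_ofReal.comp (continuous_radC hg))
  have h1 : Continuous fun x : ℝ => lift (ax (radC hg x)) + htC hg x • ez :=
    (lift.continuous.comp hax).add ((continuous_htC hg).smul continuous_const)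
  have h2 : Continuous fun x : ℝ => lift (ax (radC hg x)) + (-htC hg x) • ez :=
    (lift.continuous.comp hax).add ((continuous_htC hg).neg.smul continuous_const)
  rw [← continuousOn_univ, ← Iic_union_Ici (a := (0 : ℝ))]
  exact ContinuousOn.union_of_isClosed (h1.continuousOn.congr fun x hx => arcCFun_of_le hg hx)
    (h2.continuousOn.congr fun x hx => arcCFun_of_ge hg hx) isClosed_Iic isClosed_Ici

/-- The projection of the `C₁`-arc. [folklore] -/
theorem proj_arcCFun (hg : 2 ≤ g) (x : ℝ) : proj (arcCFun hg x) = ax (radC hg x) := by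
  rcases le_total x 0 with h | h
  · rw [arcCFun_of_le hg h, map_add, map_smul, proj_lift, proj_ez, smul_zero, add_zero]
  · rw [arcCFun_of_ge hg h, map_add, map_smul, proj_lift, proj_ez, smul_zero, add_zero]

/-- The height of the `C₁`-arc. [folklore] -/
theorem arcCFun_apply_two (hg : 2 ≤ g) (x : ℝ) : arcCFun hg x 2 = (if x ≤ 0 then htC hg x else -htC hg x) := by
  split_ifs with h
  · rw [arcCFun_of_le hg h]; simp
  · rw [arcCFun_of_ge hg (le_of_lt (not_le.1 h))]; simp

/-- `|height| = htC`. [folklore] -/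
theorem abs_arcCFun_apply_two (hg : 2 ≤ g) (x : ℝ) : |arcCFun hg x 2| = htC hg x := by
  rw [arcCFun_apply_two]
  have h0 : 0 ≤ htC hg x := Real.sqrt_nonneg _
  split_ifs
  · exact abs_of_nonneg h0
  · rw [abs_neg, abs_of_nonneg h0]

/-- **The `C₁`-arc lies on the flower surface** (`|x| ≤ 1`). [folklore] -/
theorem thicken_arcCFun (hg : 2 ≤ g) {x : ℝ} (hx : |x| ≤ 1) : thicken (flower g) (arcCFun hg x) = level g := by
  have hsq : (arcCFun hg x 2) ^ 2 = level g - prof g (radC hg x) := by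
    rw [← sq_abs, abs_arcCFun_apply_two, htC, Real.sq_sqrt (by linarith [prof_radC_le hg hx])]
  rw [thicken_apply, proj_arcCFun, flower_ax', hsq]; ring

/-- **The `C₁`-arc lies on the reduced spine** (`|x| ≤ 1`). [folklore] -/
theorem arcCFun_mem_spineZ' (hg : 2 ≤ g) {x : ℝ} (hx : |x| ≤ 1) : arcCFun hg x ∈ spineZ' g hg := by
  have hm := radC_mem hg hx
  have h7 : rt g 7 ≤ radC hg x := le_trans (rtwo_mem (by omega)).1.le hm.1
  refine (mem_spineZ'_iff hg).2 ⟨thicken_arcCFun hg hx, radC hg x, ⟨le_trans (rho1_lt_rt_seven hg).le h7, hm.2⟩, Or.inl ?_⟩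
  rw [proj_arcCFun, thlo_eq_zero_of_mem hg h7 hm.2, pol_zero_right]

/-- The `C₁`-height is positive for `0 < |x| ≤ 1` (radius `< ρ₃`, in `(7^{1/20g}, ρ₃)` where `f < c`). [folklore] -/
theorem htC_pos (hg : 2 ≤ g) {x : ℝ} (hx : |x| ≤ 1) (hx0 : x ≠ 0) : 0 < htC hg x := by
  have hm := radC_mem hg hx
  have hlt : radC hg x < rho3 hg := by
    rw [radC]; have := rtwo_lt_rho3 hg; nlinarith [abs_pos.2 hx0]
  have h7 : rt g 7 < radC hg x := lt_of_lt_of_le (rtwo_mem (by omega)).1 hm.1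
  refine Real.sqrt_pos.2 (sub_pos.2 ?_)
  -- `f < c` strictly on `(7^{1/20g}, ρ₃)`
  have hle : prof g (radC hg x) ≤ level g := prof_radC_le hg hx
  rcases hle.lt_or_eq with h | h
  · exact h
  · exfalso
    have := (level_le_prof_iff hg (le_trans (rt_pos (by norm_num)).le h7.le)).1 h.ge
    rcases this with h' | h'
    · linarith [h'.2]
    · linarith

/-- **The `C₁`-arc is injective on `[-1, 1]`.** [folklore] -/
theorem injOn_arcCFun (hg : 2 ≤ g) : InjOn (arcCFun hg) (Icc (-1) 1) := by
  intro x hx y hy h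
  have hx1 : |x| ≤ 1 := abs_le.2 ⟨hx.1, hx.2⟩
  have hy1 : |y| ≤ 1 := abs_le.2 ⟨hy.1, hy.2⟩
  have h2 := congrArg (fun p : 𝔼 3 => p 2) h
  have hr := congrArg (fun p : 𝔼 3 => ‖proj p‖) h
  simp only [proj_arcCFun, norm_ax] at hr
  have hrad : radC hg x = radC hg y := by
    have hmx := radC_mem hg hx1; have hmy := radC_mem hg hy1
    have h0 : 0 < rtwo g := lt_trans (rt_pos (by norm_num)) (rtwo_mem (g := g) (by omega)).1
    rwa [abs_of_pos (by linarith [hmx.1]), abs_of_pos (by linarith [hmy.1])] at hr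
  have habs : |x| = |y| := by
    have h := rtwo_lt_rho3 hg
    rw [radC, radC] at hrad
    nlinarith
  -- same height sign
  simp only [arcCFun_apply_two] at h2
  by_cases hx0 : x = 0
  · subst hx0; rw [abs_zero] at habs; exact (abs_eq_zero.1 habs.symm).symm
  · have hpos := htC_pos hg hx1 hx0
    have hy0 : y ≠ 0 := fun h0 => by rw [h0, abs_zero, abs_eq_zero] at habs; exact hx0 habs
    have hposy := htC_pos hg hy1 hy0
    split_ifs at h2 with h1 h3 h3
    · -- both `≤ 0`
      rcases abs_eq_abs.1 habs with h' | h'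
      · exact h'
      · linarith [lt_of_le_of_ne h1 hx0, lt_of_le_of_ne h3 hy0]
    · linarith
    · linarith
    · rcases abs_eq_abs.1 habs with h' | h'
      · exact h'
      · push Not at h1 h3; linarith

/-- **The `C₁`-arc as a continuous map of the closed unit ball of `ℝ`.** [folklore] -/
def arcC (hg : 2 ≤ g) : C(closedBall (0 : ℝ) 1, 𝔼 3) :=
  ⟨fun x => arcCFun hg x.1, (continuous_arcCFun hg).comp continuous_subtype_val⟩

/-- Points of the closed unit ball of `ℝ` have absolute value `≤ 1`. [folklore] -/
theorem abs_le_one_of_mem {x : ℝ} (hx : x ∈ closedBall (0 : ℝ) 1) : |x| ≤ 1 := by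
  rwa [mem_closedBall, dist_zero_right, Real.norm_eq_abs] at hx

/-- The `C₁`-arc is injective. [folklore] -/
theorem injective_arcC (hg : 2 ≤ g) : Injective (arcC hg) := fun x y h => by
  have hx := abs_le.1 (abs_le_one_of_mem x.2); have hy := abs_le.1 (abs_le_one_of_mem y.2)
  exact Subtype.ext (injOn_arcCFun hg ⟨hx.1, hx.2⟩ ⟨hy.1, hy.2⟩ h)

/-- **The `C₁`-arc meets the tip patch exactly in its end points.** [folklore] -/
theorem arcC_mem_tipPatch_iff (hg : 2 ≤ g) (x : closedBall (0 : ℝ) 1) : arcC hg x ∈ tipPatch g hg ↔ ‖(x : ℝ)‖ = 1 := by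
  have hx1 := abs_le_one_of_mem x.2
  have hm := radC_mem hg hx1
  have h0 : 0 < rtwo g := lt_trans (rt_pos (by norm_num)) (rtwo_mem (g := g) (by omega)).1
  have hnorm : ‖proj (arcC hg x)‖ = radC hg x.1 := by
    show ‖proj (arcCFun hg x.1)‖ = _; rw [proj_arcCFun, norm_ax, abs_of_pos (by linarith [hm.1])]
  rw [Real.norm_eq_abs]
  constructor
  · rintro ⟨-, ⟨-, hR⟩, -, ht⟩
    rw [hnorm] at hR
    -- radius `≤ 20^{1/20g}` and `|height| ≤ t₀` force `radC = r₂`, i.e. `|x| = 1`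
    have habs : |arcCFun hg x.1 2| ≤ t₀ g := ht
    rw [abs_arcCFun_apply_two, htC] at habs
    have hsq : level g - prof g (radC hg x.1) ≤ t₀ g ^ 2 := by
      have := Real.sq_sqrt (show 0 ≤ level g - prof g (radC hg x.1) by linarith [prof_radC_le hg hx1])
      rw [← this]; exact pow_le_pow_left₀ (Real.sqrt_nonneg _) habs 2
    rw [t₀_sq hg] at hsq
    -- `f` is strictly decreasing on `[7^{1/20g}, r_b] ∋ r₂, radC`
    have hanti := strictAntiOn_prof hg
    by_contra hne
    have hlt : rtwo g < radC hg x.1 := by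
      rcases hm.1.eq_or_lt with h | h
      · exfalso; apply hne
        rw [radC] at h
        have := rtwo_lt_rho3 hg
        have : (1 - |x.1|) * (rho3 hg - rtwo g) = 0 := by linarith
        rcases mul_eq_zero.1 this with h' | h'
        · linarith
        · linarith
      · exact h
    have hrb : radC hg x.1 ≤ rb hg := le_trans hR (rt_twenty_lt_rb hg).le
    have := hanti ⟨le_trans (ra_lt_rt_seven hg).le (rtwo_mem (by omega)).1.le, le_trans (rtwo_mem (by omega)).2.le (rt_twenty_lt_rb hg).le⟩
      ⟨le_trans (ra_lt_rt_seven hg).le (le_trans (rtwo_mem (by omega)).1.le hlt.le), hrb⟩ hlt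
    linarith
  · intro h1
    have hrad : radC hg x.1 = rtwo g := by rw [radC, h1]; ring
    refine ⟨thicken_arcCFun hg hx1, ⟨?_, ?_⟩, ?_, ?_⟩
    · rw [hnorm, hrad]; exact le_trans (rstar_lt_rt_seven hg).le (rtwo_mem (by omega)).1.le
    · rw [hnorm, hrad]; exact (rtwo_mem (by omega)).2.le
    · show |Complex.arg (toC (proj (arcCFun hg x.1)))| ≤ θ₀ hg
      rw [proj_arcCFun, ← pol_zero_right, arg_toC_pol (by linarith [hm.1]) ⟨by linarith [Real.pi_pos], Real.pi_pos.le⟩,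
        abs_zero]; exact (θ₀_pos hg).le
    · show |arcCFun hg x.1 2| ≤ t₀ g
      rw [abs_arcCFun_apply_two, htC, hrad, ← Real.sqrt_sq (t₀_pos hg).le, t₀_sq hg]

/-- The radius along the lens arc: `ρ₁` at `x = 0`, `r⋆⋆` at `x = ±1`. [folklore] -/
def radL (hg : 2 ≤ g) (x : ℝ) : ℝ := rho1 hg + |x| * (rss hg - rho1 hg)

/-- `ρ₁ < r⋆⋆ < 7^{1/20g}`. [folklore] -/
theorem rho1_lt_rss (hg : 2 ≤ g) : rho1 hg < rss hg := lt_trans (rho1_lt_rstar hg) (rss_mem hg).1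

/-- The lens radius lies in `[ρ₁, r⋆⋆]` for `|x| ≤ 1`. [folklore] -/
theorem radL_mem (hg : 2 ≤ g) {x : ℝ} (hx : |x| ≤ 1) : radL hg x ∈ Icc (rho1 hg) (rss hg) := by
  have h := rho1_lt_rss hg
  rw [radL]; constructor <;> nlinarith [abs_nonneg x]

/-- The lens radius is continuous. [folklore] -/
theorem continuous_radL (hg : 2 ≤ g) : Continuous (radL hg) := by unfold radL; fun_prop

/-- **The lens arc** as a map on `ℝ`: upper lens branch for `x ≤ 0`, lower for `x ≥ 0`. [folklore] -/
def arcLFun (hg : 2 ≤ g) (x : ℝ) : 𝔼 3 :=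
  if x ≤ 0 then lift (pol (radL hg x) (thlo g (radL hg x))) else lift (pol (radL hg x) (-thlo g (radL hg x)))

/-- The lens arc on `(-∞, 0]`. [folklore] -/
theorem arcLFun_of_le (hg : 2 ≤ g) {x : ℝ} (hx : x ≤ 0) : arcLFun hg x = lift (pol (radL hg x) (thlo g (radL hg x))) := by
  rw [arcLFun, if_pos hx]

/-- The lens arc on `[0, ∞)`. [folklore] -/
theorem arcLFun_of_ge (hg : 2 ≤ g) {x : ℝ} (hx : 0 ≤ x) : arcLFun hg x = lift (pol (radL hg x) (-thlo g (radL hg x))) := by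
  rcases hx.eq_or_lt with h | h
  · rw [← h, arcLFun, if_pos le_rfl, radL, abs_zero, zero_mul, add_zero,
      thlo_eq_zero_of_le_rho1 hg (rho1_pos hg).le le_rfl, neg_zero]
  · rw [arcLFun, if_neg (not_le.2 h)]

/-- The lens arc is continuous. [folklore] -/
theorem continuous_arcLFun (hg : 2 ≤ g) : Continuous (arcLFun hg) := by
  have hth : Continuous fun x : ℝ => thlo g (radL hg x) :=
    (continuousOn_thlo hg).comp_continuous (continuous_radL hg) fun x => le_trans (rho1_pos hg).le
      (by rw [radL]; nlinarith [abs_nonneg x, rho1_lt_rss hg])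
  have h1 : Continuous fun x : ℝ => lift (pol (radL hg x) (thlo g (radL hg x))) := by
    show Continuous (⇑lift ∘ (fun p : ℝ × ℝ => pol p.1 p.2) ∘ fun x : ℝ => (radL hg x, thlo g (radL hg x)))
    exact lift.continuous.comp (continuous_pol.comp ((continuous_radL hg).prodMk hth))
  have h2 : Continuous fun x : ℝ => lift (pol (radL hg x) (-thlo g (radL hg x))) := by
    show Continuous (⇑lift ∘ (fun p : ℝ × ℝ => pol p.1 p.2) ∘ fun x : ℝ => (radL hg x, -thlo g (radL hg x)))
    exact lift.continuous.comp (continuous_pol.comp ((continuous_radL hg).prodMk hth.neg))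
  rw [← continuousOn_univ, ← Iic_union_Ici (a := (0 : ℝ))]
  exact ContinuousOn.union_of_isClosed (h1.continuousOn.congr fun x hx => arcLFun_of_le hg hx)
    (h2.continuousOn.congr fun x hx => arcLFun_of_ge hg hx) isClosed_Iic isClosed_Ici

/-- The lens floor points are seam points (`ρ₁ ≤ r ≤ 7^{1/20g}`). [folklore] -/
theorem flower_pol_thlo_lens (hg : 2 ≤ g) {r : ℝ} (h1 : rho1 hg ≤ r) (h7 : r ≤ rt g 7) :
    flower g (pol r (thlo g r)) = level g :=
  (flower_pol_thlo_eq_level_iff hg (lt_of_lt_of_le (rho1_pos hg) h1) (le_trans h7 (rt_seven_lt_rho4 hg).le)).2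
    ((level_le_prof_iff hg (le_trans (rho1_pos hg).le h1)).2 (Or.inl ⟨h1, h7⟩))

/-- The projection of the lens arc. [folklore] -/
theorem proj_arcLFun (hg : 2 ≤ g) (x : ℝ) :
    proj (arcLFun hg x) = (if x ≤ 0 then pol (radL hg x) (thlo g (radL hg x)) else pol (radL hg x) (-thlo g (radL hg x))) := by
  split_ifs with h
  · rw [arcLFun_of_le hg h, proj_lift]
  · rw [arcLFun_of_ge hg (le_of_lt (not_le.1 h)), proj_lift]

/-- The lens arc has height `0`. [folklore] -/
theorem arcLFun_apply_two (hg : 2 ≤ g) (x : ℝ) : arcLFun hg x 2 = 0 := by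
  rcases le_total x 0 with h | h
  · rw [arcLFun_of_le hg h, lift_apply_two]
  · rw [arcLFun_of_ge hg h, lift_apply_two]

/-- The norm of the projection of the lens arc. [folklore] -/
theorem norm_proj_arcLFun (hg : 2 ≤ g) (x : ℝ) : ‖proj (arcLFun hg x)‖ = radL hg x := by
  have h0 : 0 ≤ radL hg x := by rw [radL]; nlinarith [abs_nonneg x, rho1_lt_rss hg, rho1_pos hg]
  rw [proj_arcLFun]; split_ifs <;> rw [norm_pol, abs_of_nonneg h0]

/-- **The lens arc lies on the reduced spine** (`|x| ≤ 1`). [folklore] -/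
theorem arcLFun_mem_spineZ' (hg : 2 ≤ g) {x : ℝ} (hx : |x| ≤ 1) : arcLFun hg x ∈ spineZ' g hg := by
  have hm := radL_mem hg hx
  have h7 : radL hg x ≤ rt g 7 := le_trans hm.2 (rss_mem hg).2.le
  have hq : flower g (pol (radL hg x) (thlo g (radL hg x))) = level g := flower_pol_thlo_lens hg hm.1 h7
  refine (mem_spineZ'_iff hg).2 ⟨?_, radL hg x, ⟨hm.1, le_trans h7 (rt_seven_lt_rho3 hg).le⟩, ?_⟩
  · rcases le_total x 0 with h | h
    · rw [arcLFun_of_le hg h, thicken_lift, hq]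
    · rw [arcLFun_of_ge hg h, thicken_lift, flower_pol_neg, hq]
  · rw [proj_arcLFun]; split_ifs
    · exact Or.inl rfl
    · exact Or.inr rfl

/-- The lens arc lies on the flower surface. [folklore] -/
theorem thicken_arcLFun (hg : 2 ≤ g) {x : ℝ} (hx : |x| ≤ 1) : thicken (flower g) (arcLFun hg x) = level g :=
  ((mem_spineZ'_iff hg).1 (arcLFun_mem_spineZ' hg hx)).1

/-- The floor angle is positive strictly inside the lens range. [folklore] -/
theorem thlo_radL_pos (hg : 2 ≤ g) {x : ℝ} (hx : |x| ≤ 1) (hx0 : x ≠ 0) : 0 < thlo g (radL hg x) := by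
  have hm := radL_mem hg hx
  have hlt : rho1 hg < radL hg x := by rw [radL]; nlinarith [abs_pos.2 hx0, rho1_lt_rss hg]
  exact thlo_pos_of_mem_lens hg hlt (lt_of_le_of_lt hm.2 (rss_mem hg).2)

/-- **The lens arc is injective on `[-1, 1]`.** [folklore] -/
theorem injOn_arcLFun (hg : 2 ≤ g) : InjOn (arcLFun hg) (Icc (-1) 1) := by
  intro x hx y hy h
  have hx1 : |x| ≤ 1 := abs_le.2 ⟨hx.1, hx.2⟩
  have hy1 : |y| ≤ 1 := abs_le.2 ⟨hy.1, hy.2⟩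
  have hr := congrArg (fun p : 𝔼 3 => ‖proj p‖) h
  simp only [norm_proj_arcLFun] at hr
  have habs : |x| = |y| := by
    rw [radL, radL] at hr; have := rho1_lt_rss hg; nlinarith
  by_cases hx0 : x = 0
  · subst hx0; rw [abs_zero] at habs; exact (abs_eq_zero.1 habs.symm).symm
  · have hy0 : y ≠ 0 := fun h0 => by rw [h0, abs_zero, abs_eq_zero] at habs; exact hx0 habs
    -- compare imaginary parts of the projections
    have him := congrArg (fun p : 𝔼 3 => (toC (proj p)).im) h
    simp only [proj_arcLFun] at him
    have hpx := thlo_radL_pos hg hx1 hx0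
    have hpy := thlo_radL_pos hg hy1 hy0
    have hrx : 0 < radL hg x := lt_of_lt_of_le (rho1_pos hg) (radL_mem hg hx1).1
    have hry : 0 < radL hg y := lt_of_lt_of_le (rho1_pos hg) (radL_mem hg hy1).1
    have hsx : 0 < Real.sin (thlo g (radL hg x)) := Real.sin_pos_of_pos_of_lt_pi hpx
      (lt_of_le_of_lt (thlo_le (by omega) _) (by
        have hg' : (2:ℝ) ≤ g := by exact_mod_cast hg
        calc π / g ≤ π / 2 := div_le_div_of_nonneg_left Real.pi_pos.le two_pos hg'
          _ < π := by linarith [Real.pi_pos]))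
    have hsy : 0 < Real.sin (thlo g (radL hg y)) := Real.sin_pos_of_pos_of_lt_pi hpy
      (lt_of_le_of_lt (thlo_le (by omega) _) (by
        have hg' : (2:ℝ) ≤ g := by exact_mod_cast hg
        calc π / g ≤ π / 2 := div_le_div_of_nonneg_left Real.pi_pos.le two_pos hg'
          _ < π := by linarith [Real.pi_pos]))
    split_ifs at him with h1 h3 h3 <;> simp only [im_toC_pol, Real.sin_neg] at him
    · rcases abs_eq_abs.1 habs with h' | h'
      · exact h'
      · linarith [lt_of_le_of_ne h1 hx0, lt_of_le_of_ne h3 hy0]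
    · nlinarith [mul_pos hrx hsx, mul_pos hry hsy]
    · nlinarith [mul_pos hrx hsx, mul_pos hry hsy]
    · rcases abs_eq_abs.1 habs with h' | h'
      · exact h'
      · push Not at h1 h3; linarith

/-- **The lens arc as a continuous map of the closed unit ball of `ℝ`.** [folklore] -/
def arcL (hg : 2 ≤ g) : C(closedBall (0 : ℝ) 1, 𝔼 3) :=
  ⟨fun x => arcLFun hg x.1, (continuous_arcLFun hg).comp continuous_subtype_val⟩

/-- The lens arc is injective. [folklore] -/
theorem injective_arcL (hg : 2 ≤ g) : Injective (arcL hg) := fun x y h => by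
  have hx := abs_le.1 (abs_le_one_of_mem x.2); have hy := abs_le.1 (abs_le_one_of_mem y.2)
  exact Subtype.ext (injOn_arcLFun hg ⟨hx.1, hx.2⟩ ⟨hy.1, hy.2⟩ h)

/-- The angle of the projection of the lens arc has absolute value `θ_lo(radL x)`. [folklore] -/
theorem abs_arg_proj_arcLFun (hg : 2 ≤ g) {x : ℝ} (hx : |x| ≤ 1) :
    |Complex.arg (toC (proj (arcLFun hg x)))| = thlo g (radL hg x) := by
  have hr : 0 < radL hg x := lt_of_lt_of_le (rho1_pos hg) (radL_mem hg hx).1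
  rw [proj_arcLFun]
  split_ifs
  · rw [arg_pol_thlo hg hr, abs_of_nonneg (thlo_nonneg _)]
  · rw [arg_pol_neg_thlo hg hr, abs_neg, abs_of_nonneg (thlo_nonneg _)]

/-- **The lens arc meets the tip patch exactly in its end points.** [folklore] -/
theorem arcL_mem_tipPatch_iff (hg : 2 ≤ g) (x : closedBall (0 : ℝ) 1) : arcL hg x ∈ tipPatch g hg ↔ ‖(x : ℝ)‖ = 1 := by
  have hx1 := abs_le_one_of_mem x.2
  have hm := radL_mem hg hx1
  rw [Real.norm_eq_abs]
  constructor
  · rintro ⟨-, ⟨hR, -⟩, hθ, -⟩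
    have hR' : rstar hg ≤ radL hg x.1 := by have := hR; rwa [show ‖proj (arcL hg x)‖ = radL hg x.1 from norm_proj_arcLFun hg _] at this
    have hθ' : thlo g (radL hg x.1) ≤ θ₀ hg := by
      have := hθ; rwa [show |Complex.arg (toC (proj (arcL hg x)))| = thlo g (radL hg x.1) from abs_arg_proj_arcLFun hg hx1] at this
    have hrss : rss hg ≤ radL hg x.1 :=
      (thlo_le_θ₀_iff hg ⟨hR', le_trans hm.2 (rss_mem hg).2.le⟩).1 hθ'
    have heq : radL hg x.1 = rss hg := le_antisymm hm.2 hrss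
    rw [radL] at heq
    have h := rho1_lt_rss hg
    have : (|x.1| - 1) * (rss hg - rho1 hg) = 0 := by linarith
    rcases mul_eq_zero.1 this with h' | h'
    · linarith
    · linarith
  · intro h1
    have hrad : radL hg x.1 = rss hg := by rw [radL, h1]; ring
    refine ⟨thicken_arcLFun hg hx1, ⟨?_, ?_⟩, ?_, ?_⟩
    · show rstar hg ≤ ‖proj (arcLFun hg x.1)‖
      rw [norm_proj_arcLFun, hrad]; exact (rss_mem hg).1.le
    · show ‖proj (arcLFun hg x.1)‖ ≤ rt g 20
      rw [norm_proj_arcLFun, hrad]; exact le_trans (rss_mem hg).2.le (rt_seven_lt_rt_twenty (by omega)).le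
    · show |Complex.arg (toC (proj (arcLFun hg x.1)))| ≤ θ₀ hg
      rw [abs_arg_proj_arcLFun hg hx1, hrad]; exact le_of_eq rfl
    · show |arcLFun hg x.1 2| ≤ t₀ g
      rw [arcLFun_apply_two, abs_zero]; exact (t₀_pos hg).le

/-- **The two arcs are disjoint** (their projections have norms `≥ r₂ > 7^{1/20g} > r⋆⋆ ≥`). [folklore] -/
theorem disjoint_arcC_arcL (hg : 2 ≤ g) : Disjoint (range (arcC hg)) (range (arcL hg)) := by
  rw [Set.disjoint_iff]
  rintro p ⟨⟨x, hx⟩, ⟨y, hy⟩⟩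
  have h1 : ‖proj p‖ = radC hg x.1 := by
    rw [← hx]; show ‖proj (arcCFun hg x.1)‖ = _
    rw [proj_arcCFun, norm_ax, abs_of_pos (by linarith [(radC_mem hg (abs_le_one_of_mem x.2)).1,
      (rtwo_mem (g := g) (by omega)).1, rt_pos (g := g) (by norm_num : (0:ℝ) < 7)])]
  have h2 : ‖proj p‖ = radL hg y.1 := by rw [← hy]; exact norm_proj_arcLFun hg y.1
  have hc := (radC_mem hg (abs_le_one_of_mem x.2)).1
  have hl := (radL_mem hg (abs_le_one_of_mem y.2)).2
  linarith [(rtwo_mem (g := g) (by omega)).1, (rss_mem hg).2]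


/-! ### §5 The free basis of the sector at the lens tip -/

/-- The two arcs indexed by the genus-one generators: `a ↦ C₁`-arc, `b ↦` lens arc. [folklore] -/
def arcs (hg : 2 ≤ g) (i : surfaceGen 1) : C(closedBall (0 : ℝ) 1, 𝔼 3) := cond i.2 (arcL hg) (arcC hg)

/-- The `a`-arc is the `C₁`-arc. [folklore] -/
@[simp] theorem arcs_false (hg : 2 ≤ g) (j : Fin 1) : arcs hg (j, false) = arcC hg := rfl

/-- The `b`-arc is the lens arc. [folklore] -/
@[simp] theorem arcs_true (hg : 2 ≤ g) (j : Fin 1) : arcs hg (j, true) = arcL hg := rfl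

/-- The left end point `-1` of the parameter interval. [folklore] -/
def ptMinus : closedBall (0 : ℝ) 1 := ⟨-1, by simp⟩

/-- The right end point `1` of the parameter interval. [folklore] -/
def ptPlus : closedBall (0 : ℝ) 1 := ⟨1, by simp⟩

/-- The straight path across the parameter interval. [folklore] -/
def straightPath : Path ptMinus ptPlus where
  toFun t := ⟨-1 + 2 * t, by
    rw [mem_closedBall, dist_zero_right, Real.norm_eq_abs, abs_le]
    constructor <;> nlinarith [t.2.1, t.2.2]⟩
  continuous_toFun := by
    refine Continuous.subtype_mk (by fun_prop) _
  source' := by apply Subtype.ext; simp [ptMinus]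
  target' := by apply Subtype.ext; simp [ptPlus]; norm_num

/-- `f ≤ c - ...`: on `[7^{1/20g}, r₂]` the axis profile is between `c - t₀²` and `c`. [folklore] -/
theorem prof_mem_of_mem (hg : 2 ≤ g) {r : ℝ} (h7 : rt g 7 ≤ r) (h2 : r ≤ rtwo g) :
    level g - t₀ g ^ 2 ≤ prof g r ∧ prof g r ≤ level g := by
  have hg1 : 1 ≤ g := by omega
  have hanti := (strictAntiOn_prof hg).antitoneOn
  have hra := (ra_lt_rt_seven hg).le
  have hrb : rtwo g ≤ rb hg := le_trans (rtwo_mem hg1).2.le (rt_twenty_lt_rb hg).le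
  constructor
  · rw [t₀_sq hg]
    have := hanti ⟨le_trans hra h7, le_trans h2 hrb⟩ ⟨le_trans hra (rtwo_mem hg1).1.le, hrb⟩ h2
    linarith
  · rw [level]
    exact hanti ⟨hra, (rt_seven_lt_rb hg).le⟩ ⟨le_trans hra h7, le_trans h2 hrb⟩ h7

/-- The radius of the `C₁` approach paths. [folklore] -/
def radA (g : ℕ) (t : ℝ) : ℝ := rt g 7 + t * (rtwo g - rt g 7)

/-- The approach radius lies in `[7^{1/20g}, r₂]`. [folklore] -/
theorem radA_mem (hg : 1 ≤ g) (t : I) : radA g t ∈ Icc (rt g 7) (rtwo g) := by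
  have h := (rtwo_mem hg).1
  rw [radA]; constructor <;> nlinarith [t.2.1, t.2.2]

/-- **The approach path along the upper branch of `C₁`** from `P` to the upper end point of the
`C₁`-arc (sign `+1`) resp. along the lower branch (sign `-1`). [folklore] -/
def approachC (hg : 2 ≤ g) (sg : ℝ) (hσ : sg = 1 ∨ sg = -1) : Path (ptP g) (arcC hg (if sg = 1 then ptMinus else ptPlus)) where
  toFun t := lift (ax (radA g t)) + (sg * Real.sqrt (level g - prof g (radA g t))) • ez
  continuous_toFun := by
    have hax : Continuous fun t : I => ax (radA g t) := by
      unfold ax radA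
      exact toC.symm.continuous.comp (Complex.continuous_ofReal.comp (by fun_prop))
    have hp := continuous_prof (g := g) (by omega)
    have hrad : Continuous fun t : I => radA g t := by unfold radA; fun_prop
    have hsc : Continuous fun t : I => sg * Real.sqrt (level g - prof g (radA g t)) :=
      continuous_const.mul (Real.continuous_sqrt.comp (continuous_const.sub (hp.comp hrad)))
    exact (lift.continuous.comp hax).add (hsc.smul continuous_const)
  source' := by
    simp only [Set.Icc.coe_zero, radA, zero_mul, add_zero]
    rw [← level, sub_self, Real.sqrt_zero, mul_zero, zero_smul, add_zero, ptP]
  target' := by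
    simp only [Set.Icc.coe_one, radA, one_mul, add_sub_cancel]
    rcases hσ with rfl | rfl
    · rw [if_pos rfl]
      show _ = arcCFun hg (-1)
      rw [arcCFun_of_le hg (by norm_num), htC, radC]; simp
    · rw [if_neg (by norm_num)]
      show _ = arcCFun hg 1
      rw [arcCFun_of_ge hg (by norm_num), htC, radC]; simp

/-- The approach paths along `C₁` stay in the tip patch. [folklore] -/
theorem approachC_mem (hg : 2 ≤ g) (sg : ℝ) (hσ : sg = 1 ∨ sg = -1) (t : I) : approachC hg sg hσ t ∈ tipPatch g hg := by
  have hg1 : 1 ≤ g := by omega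
  have hm := radA_mem hg1 t
  have hpr := prof_mem_of_mem hg hm.1 hm.2
  have hσ2 : sg ^ 2 = 1 := by rcases hσ with rfl | rfl <;> norm_num
  have hr0 : 0 < radA g t := lt_of_lt_of_le (rt_pos (by norm_num)) hm.1
  show lift (ax (radA g t)) + (sg * Real.sqrt (level g - prof g (radA g t))) • ez ∈ tipPatch g hg
  refine ⟨?_, ⟨?_, ?_⟩, ?_, ?_⟩
  · rw [thicken_apply, map_add, map_smul, proj_lift, proj_ez, smul_zero, add_zero, flower_ax']
    simp only [PiLp.add_apply, PiLp.smul_apply, lift_apply_two, ez_apply_two, smul_eq_mul, mul_one, zero_add]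
    rw [mul_pow, hσ2, one_mul, Real.sq_sqrt (by linarith [hpr.2])]; ring
  · rw [map_add, map_smul, proj_lift, proj_ez, smul_zero, add_zero, norm_ax, abs_of_pos hr0]
    exact le_trans (rstar_lt_rt_seven hg).le hm.1
  · rw [map_add, map_smul, proj_lift, proj_ez, smul_zero, add_zero, norm_ax, abs_of_pos hr0]
    exact le_trans hm.2 (rtwo_mem hg1).2.le
  · rw [map_add, map_smul, proj_lift, proj_ez, smul_zero, add_zero, ← pol_zero_right,
      arg_toC_pol hr0 ⟨by linarith [Real.pi_pos], Real.pi_pos.le⟩, abs_zero]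
    exact (θ₀_pos hg).le
  · simp only [PiLp.add_apply, PiLp.smul_apply, lift_apply_two, ez_apply_two, smul_eq_mul, mul_one, zero_add]
    rw [abs_mul, show |sg| = 1 by rcases hσ with rfl | rfl <;> norm_num, one_mul, abs_of_nonneg (Real.sqrt_nonneg _),
      ← Real.sqrt_sq (t₀_pos hg).le]
    exact Real.sqrt_le_sqrt (by linarith [hpr.1])

/-- The radius of the lens approach paths. [folklore] -/
def radB (hg : 2 ≤ g) (t : ℝ) : ℝ := rt g 7 + t * (rss hg - rt g 7)

/-- The lens approach radius lies in `[r⋆⋆, 7^{1/20g}]`. [folklore] -/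
theorem radB_mem (hg : 2 ≤ g) (t : I) : radB hg t ∈ Icc (rss hg) (rt g 7) := by
  have h := (rss_mem hg).2
  rw [radB]; constructor <;> nlinarith [t.2.1, t.2.2]

/-- **The approach path along the upper (sign `+1`) resp. lower (`-1`) lens branch** from `P` to
the corresponding end point of the lens arc. [folklore] -/
def approachL (hg : 2 ≤ g) (sg : ℝ) (hσ : sg = 1 ∨ sg = -1) : Path (ptP g) (arcL hg (if sg = 1 then ptMinus else ptPlus)) where
  toFun t := lift (pol (radB hg t) (sg * thlo g (radB hg t)))
  continuous_toFun := by
    have hrad : Continuous fun t : I => radB hg t := by unfold radB; fun_prop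
    have hth : Continuous fun t : I => thlo g (radB hg t) :=
      (continuousOn_thlo hg).comp_continuous hrad fun t =>
        show (0 : ℝ) ≤ radB hg t from ((rstar_pos hg).le.trans (rss_mem hg).1.le).trans (radB_mem hg t).1
    show Continuous (⇑lift ∘ (fun p : ℝ × ℝ => pol p.1 p.2) ∘ fun t : I => (radB hg t, sg * thlo g (radB hg t)))
    exact lift.continuous.comp (continuous_pol.comp (hrad.prodMk (continuous_const.mul hth)))
  source' := by
    simp only [Set.Icc.coe_zero, radB, zero_mul, add_zero]
    rw [thlo_eq_zero_of_mem hg le_rfl (rt_seven_lt_rho3 hg).le, mul_zero, pol_zero_right, ptP]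
  target' := by
    simp only [Set.Icc.coe_one, radB, one_mul, add_sub_cancel]
    rcases hσ with rfl | rfl
    · rw [if_pos rfl, one_mul]
      show _ = arcLFun hg (-1)
      rw [arcLFun_of_le hg (by norm_num), radL]; simp
    · rw [if_neg (by norm_num), neg_one_mul]
      show _ = arcLFun hg 1
      rw [arcLFun_of_ge hg (by norm_num), radL]; simp

/-- The approach paths along the lens stay in the tip patch. [folklore] -/
theorem approachL_mem (hg : 2 ≤ g) (sg : ℝ) (hσ : sg = 1 ∨ sg = -1) (t : I) : approachL hg sg hσ t ∈ tipPatch g hg := by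
  have hg1 : 1 ≤ g := by omega
  have hm := radB_mem hg t
  have hr0 : 0 < radB hg t := lt_of_lt_of_le (lt_trans (rstar_pos hg) (rss_mem hg).1) hm.1
  have h1 : rho1 hg ≤ radB hg t := le_trans (rho1_lt_rss hg).le hm.1
  have hseam := flower_pol_thlo_lens hg h1 hm.2
  have hq : flower g (pol (radB hg t) (sg * thlo g (radB hg t))) = level g := by
    rcases hσ with rfl | rfl
    · rw [one_mul]; exact hseam
    · rw [neg_one_mul, flower_pol_neg]; exact hseam
  show lift (pol (radB hg t) (sg * thlo g (radB hg t))) ∈ tipPatch g hg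
  refine ⟨by rw [thicken_lift, hq], ⟨?_, ?_⟩, ?_, ?_⟩
  · rw [proj_lift, norm_pol, abs_of_pos hr0]; exact le_trans (rss_mem hg).1.le hm.1
  · rw [proj_lift, norm_pol, abs_of_pos hr0]; exact le_trans hm.2 (rt_seven_lt_rt_twenty hg1).le
  · rw [proj_lift]
    have hθ : thlo g (radB hg t) ≤ θ₀ hg := (thlo_le_θ₀_iff hg ⟨le_trans (rss_mem hg).1.le hm.1, hm.2⟩).2 hm.1
    rcases hσ with rfl | rfl
    · rw [one_mul, arg_pol_thlo hg hr0, abs_of_nonneg (thlo_nonneg _)]; exact hθ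
    · rw [neg_one_mul, arg_pol_neg_thlo hg hr0, abs_neg, abs_of_nonneg (thlo_nonneg _)]; exact hθ
  · rw [lift_apply_two, abs_zero]; exact (t₀_pos hg).le

/-- The left end points of the arcs. [folklore] -/
abbrev endMinus (_i : surfaceGen 1) : closedBall (0 : ℝ) 1 := ptMinus

/-- The right end points of the arcs. [folklore] -/
abbrev endPlus (_i : surfaceGen 1) : closedBall (0 : ℝ) 1 := ptPlus

/-- **The approach paths to the left end points** (`a`: upper `C₁` branch; `b`: upper lens branch). [folklore] -/
def apprMinus (hg : 2 ≤ g) : ∀ i : surfaceGen 1, Path (ptP g) (arcs hg i (endMinus i))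
  | (_, false) => (approachC hg 1 (Or.inl rfl)).cast rfl (by rw [if_pos rfl]; rfl)
  | (_, true) => (approachL hg 1 (Or.inl rfl)).cast rfl (by rw [if_pos rfl]; rfl)

/-- **The approach paths to the right end points** (`a`: lower `C₁` branch; `b`: lower lens branch). [folklore] -/
def apprPlus (hg : 2 ≤ g) : ∀ i : surfaceGen 1, Path (ptP g) (arcs hg i (endPlus i))
  | (_, false) => (approachC hg (-1) (Or.inr rfl)).cast rfl (by rw [if_neg (by norm_num)]; rfl)
  | (_, true) => (approachL hg (-1) (Or.inr rfl)).cast rfl (by rw [if_neg (by norm_num)]; rfl)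

/-- The approach paths stay in the tip patch. [folklore] -/
theorem apprMinus_mem (hg : 2 ≤ g) (i : surfaceGen 1) (t : I) : apprMinus hg i t ∈ tipPatch g hg := by
  obtain ⟨j, b⟩ := i
  cases b
  · exact approachC_mem hg 1 (Or.inl rfl) t
  · exact approachL_mem hg 1 (Or.inl rfl) t

/-- The approach paths stay in the tip patch. [folklore] -/
theorem apprPlus_mem (hg : 2 ≤ g) (i : surfaceGen 1) (t : I) : apprPlus hg i t ∈ tipPatch g hg := by
  obtain ⟨j, b⟩ := i
  cases b
  · exact approachC_mem hg (-1) (Or.inr rfl) t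
  · exact approachL_mem hg (-1) (Or.inr rfl) t

/-- The arcs meet the tip patch exactly in their end points. [folklore] -/
theorem arcs_mem_range_iff (hg : 2 ≤ g) (i : surfaceGen 1) (x : closedBall (0 : ℝ) 1) :
    arcs hg i x ∈ range (tipChart hg) ↔ ‖(x : ℝ)‖ = 1 := by
  rw [range_tipChart hg]
  obtain ⟨j, b⟩ := i
  cases b
  · exact arcC_mem_tipPatch_iff hg x
  · exact arcL_mem_tipPatch_iff hg x

/-- The arcs are injective. [folklore] -/
theorem injective_arcs (hg : 2 ≤ g) (i : surfaceGen 1) : Injective (arcs hg i) := by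
  obtain ⟨j, b⟩ := i
  cases b
  · exact injective_arcC hg
  · exact injective_arcL hg

/-- The arcs are pairwise disjoint. [folklore] -/
theorem pairwise_disjoint_arcs (hg : 2 ≤ g) : Pairwise fun i j : surfaceGen 1 => Disjoint (range (arcs hg i)) (range (arcs hg j)) := by
  rintro ⟨i, b⟩ ⟨j, b'⟩ hne
  have hij : i = j := Subsingleton.elim _ _
  subst hij
  cases b <;> cases b'
  · exact absurd rfl hne
  · exact disjoint_arcC_arcL hg
  · exact (disjoint_arcC_arcL hg).symm
  · exact absurd rfl hne

variable (g) in
/-- **The ball with two arcs, as presented to `BallWithArcsBasis`**: the tip patch (range of the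
tip chart) together with the ranges of the two arcs. [folklore] -/
def ballArcs' (hg : 2 ≤ g) : Set (𝔼 3) := range (tipChart hg) ∪ ⋃ j, range (arcs hg j)

/-- The presented ball with arcs lies in the ball with arcs `spineZ' ∪ tipPatch`. [folklore] -/
theorem ballArcs'_subset (hg : 2 ≤ g) : ballArcs' g hg ⊆ ballArcs g hg := by
  rintro p (hp | hp)
  · right; rwa [← range_tipChart hg]
  · left
    rw [mem_iUnion] at hp
    obtain ⟨⟨j, b⟩, x, rfl⟩ := hp
    cases b
    · exact arcCFun_mem_spineZ' hg (abs_le_one_of_mem x.2)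
    · exact arcLFun_mem_spineZ' hg (abs_le_one_of_mem x.2)

/-- A point with radius parameter: `radC x = r` for `x = 1 - (r - r₂)/(ρ₃ - r₂)`. [folklore] -/
theorem radC_param (hg : 2 ≤ g) {r : ℝ} (h1 : rtwo g ≤ r) (h2 : r ≤ rho3 hg) :
    ∃ x : ℝ, 0 ≤ x ∧ x ≤ 1 ∧ radC hg x = r ∧ radC hg (-x) = r := by
  have h := rtwo_lt_rho3 hg
  have hne : rho3 hg - rtwo g ≠ 0 := (sub_pos.2 h).ne'
  have hq0 : 0 ≤ (r - rtwo g) / (rho3 hg - rtwo g) := div_nonneg (by linarith) (by linarith)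
  have hq1 : (r - rtwo g) / (rho3 hg - rtwo g) ≤ 1 := (div_le_one (sub_pos.2 h)).2 (by linarith)
  have hx0 : 0 ≤ 1 - (r - rtwo g) / (rho3 hg - rtwo g) := by linarith
  have hkey : (1 - (1 - (r - rtwo g) / (rho3 hg - rtwo g))) * (rho3 hg - rtwo g) = r - rtwo g := by
    rw [sub_sub_cancel, div_mul_cancel₀ _ hne]
  refine ⟨1 - (r - rtwo g) / (rho3 hg - rtwo g), hx0, by linarith, ?_, ?_⟩
  · rw [radC, abs_of_nonneg hx0]; linarith [hkey]
  · rw [radC, abs_neg, abs_of_nonneg hx0]; linarith [hkey]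

/-- A point with radius parameter: `radL x = r` for `x = (r - ρ₁)/(r⋆⋆ - ρ₁)`. [folklore] -/
theorem radL_param (hg : 2 ≤ g) {r : ℝ} (h1 : rho1 hg ≤ r) (h2 : r ≤ rss hg) :
    ∃ x : ℝ, 0 ≤ x ∧ x ≤ 1 ∧ radL hg x = r ∧ radL hg (-x) = r := by
  have h := rho1_lt_rss hg
  have hne : rss hg - rho1 hg ≠ 0 := (sub_pos.2 h).ne'
  have hx0 : 0 ≤ (r - rho1 hg) / (rss hg - rho1 hg) := div_nonneg (by linarith) (by linarith)
  have hx1 : (r - rho1 hg) / (rss hg - rho1 hg) ≤ 1 := (div_le_one (sub_pos.2 h)).2 (by linarith)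
  have hkey : (r - rho1 hg) / (rss hg - rho1 hg) * (rss hg - rho1 hg) = r - rho1 hg := div_mul_cancel₀ _ hne
  refine ⟨(r - rho1 hg) / (rss hg - rho1 hg), hx0, hx1, ?_, ?_⟩
  · rw [radL, abs_of_nonneg hx0]; linarith [hkey]
  · rw [radL, abs_neg, abs_of_nonneg hx0]; linarith [hkey]

/-- **The two presentations of the ball with arcs agree**: `spineZ' ∪ tipPatch = range β ∪ ⋃ arcs`. [folklore] -/
theorem ballArcs'_eq (hg : 2 ≤ g) : ballArcs' g hg = ballArcs g hg := by
  refine Subset.antisymm (ballArcs'_subset hg) ?_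
  have hg1 : 1 ≤ g := by omega
  rintro p (hp | hp)
  · -- a point of the reduced spine
    obtain ⟨hq, r, ⟨hr1, hr3⟩, h⟩ := (mem_spineZ'_iff hg).1 hp
    have hr0 : 0 < r := lt_of_lt_of_le (rho1_pos hg) hr1
    have hnorm : ‖proj p‖ = r := by rcases h with h | h <;> rw [h, norm_pol, abs_of_pos hr0]
    have hpZ : p ∈ double (flower g) (level g) := hq
    rcases le_or_gt r (rss hg) with hA | hA
    · -- lens arc
      right; rw [mem_iUnion]
      have hseam := flower_pol_thlo_lens hg hr1 (le_trans hA (rss_mem hg).2.le)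
      have hqc : flower g (proj p) = level g := by
        rcases h with h | h
        · rw [h]; exact hseam
        · rw [h, flower_pol_neg]; exact hseam
      have hp2 : p 2 = 0 := (apply_two_eq_zero_iff hpZ).2 hqc
      have hpl : p = lift (proj p) := (eq_lift_proj_iff p).2 hp2
      obtain ⟨x, hx0, hx1, hxr, hxr'⟩ := radL_param hg hr1 hA
      refine ⟨(0, true), ?_⟩
      rcases h with h | h
      · refine ⟨⟨-x, by rw [mem_closedBall, dist_zero_right, Real.norm_eq_abs, abs_neg, abs_of_nonneg hx0]; exact hx1⟩, ?_⟩
        show arcLFun hg (-x) = p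
        rw [arcLFun_of_le hg (by linarith), hxr', ← h, ← hpl]
      · refine ⟨⟨x, by rw [mem_closedBall, dist_zero_right, Real.norm_eq_abs, abs_of_nonneg hx0]; exact hx1⟩, ?_⟩
        show arcLFun hg x = p
        rw [arcLFun_of_ge hg hx0, hxr, ← h, ← hpl]
    · rcases le_or_gt r (rtwo g) with hB | hB
      · -- inside the tip patch
        left; rw [range_tipChart hg]
        refine ⟨hq, ⟨?_, ?_⟩, ?_, ?_⟩
        · rw [hnorm]; exact le_trans (rss_mem hg).1.le hA.le
        · rw [hnorm]; exact le_trans hB (rtwo_mem hg1).2.le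
        · rcases le_or_gt r (rt g 7) with h7 | h7
          · have hθ : thlo g r ≤ θ₀ hg := (thlo_le_θ₀_iff hg ⟨le_trans (rss_mem hg).1.le hA.le, h7⟩).2 hA.le
            rcases h with h | h
            · rw [h, arg_pol_thlo hg hr0, abs_of_nonneg (thlo_nonneg _)]; exact hθ
            · rw [h, arg_pol_neg_thlo hg hr0, abs_neg, abs_of_nonneg (thlo_nonneg _)]; exact hθ
          · have h0 : thlo g r = 0 := thlo_eq_zero_of_mem hg h7.le hr3
            have : proj p = ax r := by
              rcases h with h | h
              · rw [h, h0, pol_zero_right]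
              · rw [h, h0, neg_zero, pol_zero_right]
            rw [this, ← pol_zero_right, arg_toC_pol hr0 ⟨by linarith [Real.pi_pos], Real.pi_pos.le⟩, abs_zero]
            exact (θ₀_pos hg).le
        · -- the height: `p₂² = c - q(π p) ≤ t₀²`
          have hsq : p 2 ^ 2 = level g - flower g (proj p) := sq_eq_of_mem hpZ
          rcases le_or_gt r (rt g 7) with h7 | h7
          · have hseam := flower_pol_thlo_lens hg hr1 h7
            have hqc : flower g (proj p) = level g := by
              rcases h with h | h
              · rw [h]; exact hseam
              · rw [h, flower_pol_neg]; exact hseam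
            rw [(apply_two_eq_zero_iff hpZ).2 hqc, abs_zero]; exact (t₀_pos hg).le
          · have h0 : thlo g r = 0 := thlo_eq_zero_of_mem hg h7.le hr3
            have hπ : proj p = ax r := by
              rcases h with h | h
              · rw [h, h0, pol_zero_right]
              · rw [h, h0, neg_zero, pol_zero_right]
            rw [hπ, flower_ax'] at hsq
            have hpr := prof_mem_of_mem hg h7.le hB
            rw [← Real.sqrt_sq (abs_nonneg (p 2)), ← Real.sqrt_sq (t₀_pos hg).le, sq_abs]
            exact Real.sqrt_le_sqrt (by linarith [hpr.1])
      · -- `C₁`-arc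
        right; rw [mem_iUnion]
        have h0 : thlo g r = 0 := thlo_eq_zero_of_mem hg (le_trans (rtwo_mem hg1).1.le hB.le) hr3
        have hπ : proj p = ax r := by
          rcases h with h | h
          · rw [h, h0, pol_zero_right]
          · rw [h, h0, neg_zero, pol_zero_right]
        obtain ⟨x, hx0, hx1, hxr, hxr'⟩ := radC_param hg hB.le hr3
        have hsq : p 2 ^ 2 = level g - prof g r := by rw [sq_eq_of_mem hpZ, hπ, flower_ax']
        refine ⟨(0, false), ?_⟩
        rcases le_total 0 (p 2) with hs | hs
        · refine ⟨⟨-x, by rw [mem_closedBall, dist_zero_right, Real.norm_eq_abs, abs_neg, abs_of_nonneg hx0]; exact hx1⟩, ?_⟩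
          show arcCFun hg (-x) = p
          rw [arcCFun_of_le hg (by linarith), htC, hxr', ← hπ]
          have : Real.sqrt (level g - prof g r) = p 2 := by rw [← hsq, Real.sqrt_sq hs]
          rw [this, lift_proj_add]
        · refine ⟨⟨x, by rw [mem_closedBall, dist_zero_right, Real.norm_eq_abs, abs_of_nonneg hx0]; exact hx1⟩, ?_⟩
          show arcCFun hg x = p
          rw [arcCFun_of_ge hg hx0, htC, hxr, ← hπ]
          have : -Real.sqrt (level g - prof g r) = p 2 := by
            rw [← hsq, Real.sqrt_sq_eq_abs, abs_of_nonpos hs, neg_neg]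
          rw [this, lift_proj_add]
  · left; rwa [range_tipChart hg]

/-- **The presented ball with arcs lies in the sector.** [folklore] -/
theorem ballArcs'_subset_sectorZ (hg : 2 ≤ g) : ballArcs' g hg ⊆ sectorZ g :=
  (ballArcs'_subset hg).trans (ballArcs_subset_sectorZ hg)

/-- `P` lies in the presented ball with arcs. [folklore] -/
theorem ptP_mem_ballArcs' (hg : 2 ≤ g) : ptP g ∈ ballArcs' g hg :=
  Or.inl (by rw [range_tipChart hg]; exact ptP_mem_tipPatch hg)

/-- **On fundamental groups the inclusion of the presented ball with arcs into the sector is an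
isomorphism.** [folklore] -/
theorem bijective_inclHom_ballArcs'_sectorZ (hg : 2 ≤ g) :
    Bijective (VanKampen.inclHomOfSubset (ballArcs'_subset_sectorZ hg) (ptP g) (ptP_mem_ballArcs' hg)
      (ballArcs'_subset_sectorZ hg (ptP_mem_ballArcs' hg))) := by
  have hsub : spineZ' g hg ⊆ ballArcs' g hg := by rw [ballArcs'_eq hg]; exact subset_union_left
  have hsdr : IsStrongDeformationRetractOf (spineZ' g hg) (ballArcs' g hg) := by
    rw [ballArcs'_eq hg]; exact spineZ'_isStrongDeformationRetractOf_ballArcs hg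
  exact VanKampen.bijective_inclHomOfSubset_of_bijective_of_bijective hsub (ballArcs'_subset_sectorZ hg)
    (ptP_mem_spineZ' hg)
    (VanKampen.bijective_inclHomOfSubset_of_isStrongDeformationRetractOf hsdr hsub (ptP_mem_spineZ' hg))
    (VanKampen.bijective_inclHomOfSubset_of_isStrongDeformationRetractOf
      (spineZ'_isStrongDeformationRetractOf_sectorZ hg) (spineZ'_subset_sectorZ hg) (ptP_mem_spineZ' hg))

/-- The approach paths to the left end points stay in the range of the tip chart. [folklore] -/
theorem apprMinus_mem_range (hg : 2 ≤ g) (i : surfaceGen 1) (t : I) : apprMinus hg i t ∈ range (tipChart hg) := by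
  rw [range_tipChart hg]; exact apprMinus_mem hg i t

/-- The approach paths to the right end points stay in the range of the tip chart. [folklore] -/
theorem apprPlus_mem_range (hg : 2 ≤ g) (i : surfaceGen 1) (t : I) : apprPlus hg i t ∈ range (tipChart hg) := by
  rw [range_tipChart hg]; exact apprPlus_mem hg i t

/-- `P` lies in the range of the tip chart. [folklore] -/
theorem ptP_mem_range_tipChart (hg : 2 ≤ g) : ptP g ∈ range (tipChart hg) := by
  rw [range_tipChart hg]; exact ptP_mem_tipPatch hg

/-- **The arc loops of the sector** at `P`, traversed from the right end point to the left one: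
`α⁺ · (arc)⁻ · (α⁻)⁻¹` for the `C₁`-arc (`a`: down the lower branch of `C₁` to `Q`, back along the
upper branch) and the lens arc (`b`: along the lower lens branch to `I`, back along the upper one),
as loops of `ℝ³`. [folklore] -/
def arcLoop (hg : 2 ≤ g) (i : surfaceGen 1) : Path (ptP g) (ptP g) :=
  ((apprPlus hg i).trans (straightPath.symm.map (arcs hg i).continuous)).trans (apprMinus hg i).symm

/-- The arc loops lie in the presented ball with arcs. [folklore] -/
theorem arcLoop_mem (hg : 2 ≤ g) (i : surfaceGen 1) (t : I) : arcLoop hg i t ∈ ballArcs' g hg :=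
  arcLoop_mem_union_iUnion (B := range (tipChart hg)) (A := fun j => range (arcs hg j)) i (apprPlus hg i)
    (straightPath.symm.map (arcs hg i).continuous) (apprMinus hg i) (apprPlus_mem_range hg i)
    (fun _ => mem_range_self _) (apprMinus_mem_range hg i) t

/-- The arc loops lie in the sector. [folklore] -/
theorem arcLoop_mem_sectorZ (hg : 2 ≤ g) (i : surfaceGen 1) (t : I) : arcLoop hg i t ∈ sectorZ g :=
  ballArcs'_subset_sectorZ hg (arcLoop_mem hg i t)

/-- **The free basis of the fundamental group of a sector at the lens tip.**  There is an
isomorphism `F⟨a, b⟩ ≅ π₁(sector, P)` sending `a` to the class of the `C₁`-arc loop and `b` to the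
class of the lens arc loop (Hatcher, Example 1.22 and Prop. 1.17: the sector deformation retracts
onto the ball with two arcs `tipPatch ∪ C₁ ∪ L`). [cite: HatcherAT2002, Example 1.22 (p. 43), Prop. 1.17] -/
theorem exists_mulEquiv_sectorZ_apply (hg : 2 ≤ g) :
    ∃ e : FreeGroup (surfaceGen 1) ≃* _root_.FundamentalGroup ↥(sectorZ g) ⟨ptP g, ballArcs'_subset_sectorZ hg (ptP_mem_ballArcs' hg)⟩,
      ∀ i, e (FreeGroup.of i) = _root_.FundamentalGroup.fromPath (Path.Homotopic.Quotient.mk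
        (VanKampen.liftPath (sectorZ g) (arcLoop hg i) (arcLoop_mem_sectorZ hg i))) := by
  haveI : Fact ((0 : ℝ) < 1) := ⟨one_pos⟩
  obtain ⟨e₁, he₁⟩ := exists_mulEquiv_apply_of_eq_arcLoop (Z := 𝔼 3) (F := ℝ × ℝ) (E := fun _ : surfaceGen 1 => ℝ)
    (tipChart hg) (injective_tipChart hg) (fun _ => Module.finrank_self ℝ) (arcs hg) (arcs_mem_range_iff hg)
    (injective_arcs hg) (pairwise_disjoint_arcs hg) endPlus endMinus (fun _ => by simp [ptPlus])
    (fun _ => by simp [ptMinus, ptPlus]) (fun _ => straightPath.symm) (ptP_mem_range_tipChart hg)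
    (apprPlus hg) (apprPlus_mem_range hg) (apprMinus hg) (apprMinus_mem_range hg)
  set e₂ := MulEquiv.ofBijective _ (bijective_inclHom_ballArcs'_sectorZ hg)
  refine ⟨e₁.trans e₂, fun i => ?_⟩
  rw [MulEquiv.trans_apply, he₁ i]
  exact VanKampen.inclHomOfSubset_fromPath_liftPath (ballArcs'_subset_sectorZ hg) (ptP_mem_ballArcs' hg)
    (ballArcs'_subset_sectorZ hg (ptP_mem_ballArcs' hg)) _ _

end FlowerModel

end Literature.Topology.FourManifolds
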